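import Mathlib.MeasureTheory.Integral.IntervalIntegral.FundThmCalculus
import Mathlib.MeasureTheory.Integral.Prod
import Mathlib.MeasureTheory.Function.AEEqOfIntegral
import Literature.NumberTheory.Automorphic.AutomorphicRepsGLClosureAnalytic
import Literature.NumberTheory.Automorphic.AutomorphicSpectrumProofs
import HarnessLib

/-!
# The `L²`-derivative along a one-parameter subgroup via the Bochner integral (no boundedness),
# and Step 3a of Borel–Jacquet 4.6 from Harish-Chandra's Lemma 34 alone

Topic `NumberTheory/Automorphic`; sibling file of `AutomorphicFormsL2Derivative` and of
`AutomorphicRepsGLClosureAnalytic`. The former proves that the difference quotients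
`t⁻¹ (R(exp tX) [f] - [f])` of the regular representation on `L²(μ)` converge to the class `[f_X]`
of the Lie derivative `X φ = invQuot f_X` of `φ = invQuot f`, PROVIDED `X φ` is bounded (dominated
convergence), and the latter therefore reduces Step 3a (`formsOfL2_closure_exp_invariant hcpt μ`)
to Harish-Chandra's Lemma 34 (`formsOfL2_coeff_analyticAt hcpt μ`) together with the boundedness
of cusp forms (`cuspidal_bounded hcpt`). Here the boundedness hypothesis is removed: for an
automorphic measure `μ` (finite, invariant, strongly continuous regular representation) and
`f, f_X ∈ ℒ²(μ)` with `φ = invQuot f` archimedean-smooth and `X φ = invQuot f_X`,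

  `R(exp tX) [f] = [f] + ∫₀ᵗ R(exp sX) [f_X] ds`  in `L²(μ)`

(`rightRegular_expMem_toLp_eq_add_intervalIntegral`, the integral being the Bochner integral of
the continuous `L²`-valued orbit map of `[f_X]`), because both sides have the representative
`[y] ↦ φ (y⁻¹ exp tX) = φ (y⁻¹) + ∫₀ᵗ (X φ)(y⁻¹ exp sX) ds` (the fundamental theorem of calculus
along the curve, `IsArchSmooth.sub_eq_intervalIntegral_lieDeriv`, and the a.e. evaluation of
`L²`-valued Bochner integrals of translates, `AdelicGroupData.coeFn_integral_rightRegular_toLp`,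
proved by testing against indicators and Fubini); hence (`hasDerivAt_rightRegular_expMem_toLp`,
the fundamental theorem of calculus for the continuous integrand) the orbit map of `[f]` is
differentiable at `t = 0` with derivative `[f_X]`. This is Harish-Chandra 1953, §9 (p. 227: on
Gårding-type vectors `π(X)` is the Lie derivative) and the formula `π_W(X) ψ = lim t⁻¹ {π(exp tX) ψ
- ψ}` (§7, p. 209; proof of Thm. 5, p. 229) for vectors represented by smooth functions with
square-integrable Lie derivative; Getz–Hahn 2024, Def. 4.5 (b) and §6.5.

Consequently (`closure_l2OfForms_exp_invariant_of_analytic_of_memLp`, the Corollary to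
Harish-Chandra's Thm. 2 exactly as in `AutomorphicRepsGLClosureAnalytic` but without the
boundedness hypothesis) Step 3a of `AutomorphicRepsGLCuspidalL2Step3` follows from the named fact
`formsOfL2_coeff_analyticAt hcpt μ` ALONE (`AutomorphicRepsGL.formsOfL2_closure_exp_invariant_of_
coeff_analyticAt'`): the elements of a stable `W ≤ V_Π` and their Lie derivatives are, by the very
definition of `V_Π`, inversions of square-integrable functions. The trust base of F3a is thus
`{formsOfL2_coeff_analyticAt}`. Everything in this file is proved.

Contents:
* `continuous_expGL_smul`, `AutomorphyDatum.continuous_ofArch_expMem_smul` — continuity of the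
  one-parameter subgroups `t ↦ exp tX` in `GL N A` and in `G(𝔸_K)`.
* `IsArchSmooth.contDiff_expMem_smul`, `IsArchSmooth.continuous_lieDeriv_expMem_smul`,
  `IsArchSmooth.sub_eq_intervalIntegral_lieDeriv` — `φ (g exp tX) - φ g = ∫₀ᵗ (X φ)(g exp sX) ds`.
* `AdelicGroupData.quasiMeasurePreserving_curve_smul`, `AdelicGroupData.integrable_mul_comp_curve_
  smul`, `AdelicGroupData.coeFn_integral_rightRegular_toLp` — for a continuous curve `c` in
  `G(𝔸_K)` and a finite measure `ρ` on `ℝ`, the Bochner integral `∫ R(c r) [F] dρ(r)` in `L²(μ)`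
  has the representative `y ↦ ∫ F((c r)⁻¹ • y) dρ(r)`.
* `apply_inv_smul_sub_eq_intervalIntegral`, `rightRegular_expMem_toLp_eq_add_intervalIntegral`,
  `hasDerivAt_rightRegular_expMem_toLp`, `hasDerivAt_inner_rightRegular_toLp_of_memLp`.
* `closure_l2OfForms_exp_invariant_of_analytic_of_memLp`,
  `AutomorphicRepsGL.formsOfL2_closure_exp_invariant_of_coeff_analyticAt'`.

## Design notes

* Everything up to the derivative is stated for a general adelic group datum `𝒢`, automorphy
  datum `𝒟` and automorphic measure `μ` (`[𝒢.IsAutomorphicMeasure μ]`, which supplies finiteness,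
  invariance and, through `isStronglyContinuous_rightRegular_holds`, the continuity of the
  `L²`-valued orbit maps); no measurable structure on `G(𝔸_K)` is used (the curve is composed
  with the continuous action, and `ℝ × (G(𝔸_K) ⧸ A_G G(K))` carries the Borel product
  structure). The interchange of Bochner integral and evaluation follows the pattern of
  `coeFn_integral_smul_domSMul_ae_eq` of `InvariantMeasureDomination` (pairing with indicators,
  Hölder and Fubini), for curves instead of compactly supported weights on the group.
* On the analyticity side the references are those of `AutomorphicRepsGLClosureAnalytic`; for
  the reductive (rather than semisimple) archimedean group `GL_n(K_∞)` the analyticity of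
  `K`-finite vectors of admissible representations is Knapp, *Representation Theory of Semisimple
  Groups*, Thm. 8.7 (linear connected reductive groups) and Wallach, *Real Reductive Groups I*,
  3.4.9 (review remark on p22136; neither held).
* No definition, no instance, no `sorry`; (H5) `open scoped Classical`.

## References

* Harish-Chandra, *Representations of a semisimple Lie group on a Banach space. I*, Trans. AMS 75
  (1953), 185–243 (held): §7 (p. 209), Cor. to Thm. 2 (pp. 210–211), §9 (p. 227), Lemma 34 and
  Thm. 5 (pp. 228–229) [HarishChandraTAMS1953].
* M. Libine, *Introduction to Representations of Real Semisimple Lie Groups*, arXiv:1212.2578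
  (held): Thm. 72, Cor. 73 [Libine2012].
* J. R. Getz, H. Hahn, *An Introduction to Automorphic Representations*, GTM 300 (2024) (held):
  §4.2, Def. 4.5, Lemma 4.4.3, §6.5 [GetzHahn2024].
* A. Borel, H. Jacquet, *Automorphic forms and automorphic representations*, Proc. Sympos. Pure
  Math. 33 (1979), Part 1, §4.6 [BorelJacquetCorvallis1979] (not held).
-/

open scoped MatrixGroups Matrix ContDiff Classical Topology InnerProductSpace ENNReal NNReal
open NumberField Filter Set
open _root_.MeasureTheory _root_.MeasureTheory.Measure

noncomputable section

namespace Literature.NumberTheory.Automorphic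

/-! ### 1. One-parameter subgroups: continuity and the fundamental theorem of calculus -/

section ExpCurve

variable {A : Type*} [NormedCommRing A] [NormedAlgebra ℚ A] [CompleteSpace A] [NormedAlgebra ℝ A]
  {N : Type*} [Fintype N] [DecidableEq N]

-- As in `Mathlib/Analysis/Normed/Algebra/MatrixExponential.lean` and `ArchimedeanLieDerivSmooth`:
-- the scoped `L∞`-operator normed ring structure on matrices is only reducibly-defeq to the Pi
-- uniformity, so the continuity of `exp` on `Matrix N N A` needs this setting.
set_option backward.isDefEq.respectTransparency false in
open scoped Matrix.Norms.Operator in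
/-- **The one-parameter subgroup `t ↦ exp tX` of `GL N A` is continuous** (`exp` is continuous
on the Banach algebra `Matrix N N A`, and so is `t ↦ exp (-tX) = (exp tX)⁻¹`). Knapp, *Lie Groups
Beyond an Introduction*, 0.§2. [folklore] -/
theorem continuous_expGL_smul (X : Matrix N N A) : Continuous fun t : ℝ ↦ expGL (t • X) := by
  refine Units.continuous_iff.2 ⟨?_, ?_⟩
  · change Continuous fun t : ℝ ↦ NormedSpace.exp (t • X)
    exact NormedSpace.exp_continuous.comp (continuous_id.smul continuous_const)
  · have h : (fun t : ℝ ↦ (↑(expGL (t • X))⁻¹ : Matrix N N A)) =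
        fun t : ℝ ↦ NormedSpace.exp (-(t • X)) := by
      funext t
      rw [← expGL_neg]
      rfl
    change Continuous fun t : ℝ ↦ (↑(expGL (t • X))⁻¹ : Matrix N N A)
    rw [h]
    exact NormedSpace.exp_continuous.comp (continuous_id.smul continuous_const).neg

variable [StarRing A] {H : RealMatrixGroup A N}

/-- The one-parameter subgroup `t ↦ exp tX : ℝ → G_∞` of `X ∈ 𝔤` is continuous. Knapp, 0.§2. [folklore] -/
theorem RealMatrixGroup.continuous_expMem_smul (X : H.lie) :
    Continuous fun t : ℝ ↦ H.expMem (t • X) :=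
  continuous_induced_rng.2 (continuous_expGL_smul (X : Matrix N N A))

variable {G : Type*} [Group G] (ι : H.carrier →* G)

-- the normed structure on `𝔤 ≤ Matrix N N A` used by `IsArchSmooth` is the scoped operator norm
set_option backward.isDefEq.respectTransparency false in
open scoped Matrix.Norms.Operator in
/-- For `φ` smooth in the archimedean variable, the curve `t ↦ φ (g exp tX)` is `C^∞` (the smooth
slice `Y ↦ φ (g exp Y)` composed with the line `t ↦ tX`). Borel–Jacquet 1979, §1.5. [folklore] -/
theorem IsArchSmooth.contDiff_expMem_smul {φ : G → ℂ} (hφ : IsArchSmooth ι φ) (X : H.lie)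
    (g : G) : ContDiff ℝ ∞ fun t : ℝ ↦ φ (g * ι (H.expMem (t • X))) := by
  -- Mathlib idiom (Mathlib/Algebra/Lie/OfAssociative.lean), needed to name `𝔤.toSubmodule`
  letI : LieRing (Matrix N N A) := LieRing.ofAssociativeRing
  set v : H.lie.toSubmodule := ⟨X, X.2⟩ with hv
  have hL : ContDiff ℝ ∞ fun t : ℝ ↦ t • v := contDiff_id.smul contDiff_const
  exact (hφ g).comp hL

/-- For `φ` smooth in the archimedean variable, `s ↦ (X φ)(g exp sX)` is continuous: it is the
derivative (`IsArchSmooth.hasDerivAt_expMem_smul`) of the smooth curve `t ↦ φ (g exp tX)`.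
Borel–Jacquet 1979, §1.5. [folklore] -/
theorem IsArchSmooth.continuous_lieDeriv_expMem_smul {φ : G → ℂ} (hφ : IsArchSmooth ι φ)
    (X : H.lie) (g : G) : Continuous fun s : ℝ ↦ lieDeriv ι X φ (g * ι (H.expMem (s • X))) := by
  have h1 : deriv (fun t : ℝ ↦ φ (g * ι (H.expMem (t • X)))) =
      fun s ↦ lieDeriv ι X φ (g * ι (H.expMem (s • X))) :=
    funext fun s ↦ (hφ.hasDerivAt_expMem_smul ι X g s).deriv
  rw [← h1]
  exact (hφ.contDiff_expMem_smul ι X g).continuous_deriv (by simp)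

/-- **The fundamental theorem of calculus along a one-parameter subgroup**:
`φ (g exp tX) - φ g = ∫₀ᵗ (X φ)(g exp sX) ds` for `φ` smooth in the archimedean variable
(`intervalIntegral.integral_eq_sub_of_hasDerivAt` with `IsArchSmooth.hasDerivAt_expMem_smul` and
the continuity of the integrand). Harish-Chandra 1953, §7 (p. 209); Borel–Jacquet 1979, §1.5. [folklore] -/
theorem IsArchSmooth.sub_eq_intervalIntegral_lieDeriv {φ : G → ℂ} (hφ : IsArchSmooth ι φ)
    (X : H.lie) (g : G) (t : ℝ) :
    φ (g * ι (H.expMem (t • X))) - φ g =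
      ∫ s in (0 : ℝ)..t, lieDeriv ι X φ (g * ι (H.expMem (s • X))) := by
  have h := intervalIntegral.integral_eq_sub_of_hasDerivAt
    (fun s _ ↦ hφ.hasDerivAt_expMem_smul ι X g s)
    ((hφ.continuous_lieDeriv_expMem_smul ι X g).intervalIntegrable 0 t)
  rw [h, RealMatrixGroup.expMem_zero_smul, map_one, mul_one]

end ExpCurve

/-! ### 2. Bochner integrals of translates in `L²` of the automorphic quotient -/

namespace AdelicGroupData

variable {K : Type} [Field K] [NumberField K] (𝒢 : AdelicGroupData K)
  (μ : Measure 𝒢.automorphicQuotient) [𝒢.IsAutomorphicMeasure μ]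

/-- For a continuous curve `d` in `G(𝔸_K)` and an s-finite measure `ρ` on `ℝ`, the map
`(r, y) ↦ d(r) • y` is quasi-measure-preserving from `ρ ⊗ μ` to the invariant measure `μ`
(Tonelli: every fibre `y ↦ d(r) • y` preserves `μ`). [folklore] -/
theorem quasiMeasurePreserving_curve_smul {d : ℝ → 𝒢.Adelic} (hd : Continuous d)
    (ρ : Measure ℝ) [SFinite ρ] :
    QuasiMeasurePreserving (fun p : ℝ × 𝒢.automorphicQuotient ↦ d p.1 • p.2) (ρ.prod μ) μ := by
  have hT : Measurable fun p : ℝ × 𝒢.automorphicQuotient ↦ d p.1 • p.2 :=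
    ((hd.comp continuous_fst).smul continuous_snd).measurable
  refine ⟨hT, Measure.AbsolutelyContinuous.mk fun s hs hs0 ↦ ?_⟩
  rw [Measure.map_apply hT hs, Measure.prod_apply (hT hs)]
  have : ∀ r : ℝ,
      μ (Prod.mk r ⁻¹' ((fun p : ℝ × 𝒢.automorphicQuotient ↦ d p.1 • p.2) ⁻¹' s)) = μ s :=
    fun r ↦ measure_preimage_smul μ (d r) s
  simp_rw [this, hs0, lintegral_zero]

/-- For `F, ψ ∈ ℒ²(μ)`, a continuous curve `d` in `G(𝔸_K)` and a finite measure `ρ` on `ℝ`, the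
function `(r, y) ↦ ψ(y) F(d(r) • y)` is integrable on `ℝ × (G(𝔸_K) ⧸ A_G G(K))` for `ρ ⊗ μ`: by
Hölder and the invariance of `μ` each fibre has `L¹`-norm at most `‖ψ‖₂ ‖F‖₂` (cf.
`integral_mul_orbitalSmoothing` of `InvariantMeasureDomination`). [folklore] -/
theorem integrable_mul_comp_curve_smul {d : ℝ → 𝒢.Adelic} (hd : Continuous d)
    (ρ : Measure ℝ) [IsFiniteMeasure ρ] {F ψ : 𝒢.automorphicQuotient → ℂ} (hF : MemLp F 2 μ)
    (hψ : MemLp ψ 2 μ) :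
    Integrable (fun p : ℝ × 𝒢.automorphicQuotient ↦ ψ p.2 * F (d p.1 • p.2)) (ρ.prod μ) := by
  have hFd : ∀ r, MemLp (fun x ↦ F (d r • x)) 2 μ := fun r ↦
    hF.comp_measurePreserving (measurePreserving_smul (d r) μ)
  have hnorm : ∀ r, eLpNorm (fun x ↦ F (d r • x)) 2 μ = eLpNorm F 2 μ := fun r ↦
    eLpNorm_comp_measurePreserving hF.1 (measurePreserving_smul (d r) μ)
  have hprod : ∀ r, MemLp (fun x ↦ ψ x * F (d r • x)) 1 μ := fun r ↦ (hFd r).mul' hψ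
  set M : ℝ := (eLpNorm ψ 2 μ * eLpNorm F 2 μ).toReal with hM
  have hMfin : eLpNorm ψ 2 μ * eLpNorm F 2 μ ≠ ⊤ := ENNReal.mul_ne_top hψ.2.ne hF.2.ne
  have hL1 : ∀ r, ∫ x, ‖ψ x * F (d r • x)‖ ∂μ ≤ M := by
    intro r
    rw [integral_norm_eq_lintegral_enorm (hprod r).1, ← eLpNorm_one_eq_lintegral_enorm, hM]
    refine ENNReal.toReal_mono hMfin ?_
    calc eLpNorm (fun x ↦ ψ x * F (d r • x)) 1 μ
        ≤ (1 : ℝ≥0) * eLpNorm ψ 2 μ * eLpNorm (fun x ↦ F (d r • x)) 2 μ :=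
          eLpNorm_le_eLpNorm_mul_eLpNorm'_of_norm hψ.1 (hFd r).1 (· * ·) 1
            (Eventually.of_forall fun x ↦ by simp)
      _ = eLpNorm ψ 2 μ * eLpNorm F 2 μ := by rw [hnorm r, ENNReal.coe_one, one_mul]
  have hm : AEStronglyMeasurable (fun p : ℝ × 𝒢.automorphicQuotient ↦ ψ p.2 * F (d p.1 • p.2))
      (ρ.prod μ) :=
    (hψ.1.comp_quasiMeasurePreserving quasiMeasurePreserving_snd).mul
      (hF.1.comp_quasiMeasurePreserving (𝒢.quasiMeasurePreserving_curve_smul μ hd ρ))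
  rw [integrable_prod_iff hm]
  constructor
  · exact Eventually.of_forall fun r ↦ memLp_one_iff_integrable.1 (hprod r)
  · refine (integrable_const M).mono' hm.norm.integral_prod_right'
      (Eventually.of_forall fun r ↦ ?_)
    rw [Real.norm_of_nonneg (integral_nonneg fun _ ↦ norm_nonneg _)]
    exact hL1 r

/-- **The `L²`-valued Bochner integral of translates along a curve, evaluated pointwise.** For a
continuous curve `c` in `G(𝔸_K)`, a finite measure `ρ` on `ℝ` and `F ∈ ℒ²(μ)`, the Bochner
integral `∫ R(c(r)) [F] dρ(r)` in `L²(μ)` — of the continuous (strong continuity of `R`) bounded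
orbit map — has the representative `y ↦ ∫ F((c r)⁻¹ • y) dρ(r)`: both have the same integral
over every measurable `A` (pairing with the indicator of `A`, `integral_inner`, the a.e. formula
`(R(g) [F])(y) = F(g⁻¹ • y)`, and Fubini, `integrable_mul_comp_curve_smul`). Pattern of
`coeFn_integral_smul_domSMul_ae_eq` of `InvariantMeasureDomination`. [folklore] -/
theorem coeFn_integral_rightRegular_toLp {c : ℝ → 𝒢.Adelic} (hc : Continuous c)
    (ρ : Measure ℝ) [IsFiniteMeasure ρ] {F : 𝒢.automorphicQuotient → ℂ} (hF : MemLp F 2 μ) :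
    ((∫ r, 𝒢.rightRegular μ (c r) (hF.toLp F) ∂ρ : 𝒢.L2 μ) : 𝒢.automorphicQuotient → ℂ) =ᵐ[μ]
      fun y ↦ ∫ r, F ((c r)⁻¹ • y) ∂ρ := by
  set γ : ℝ → 𝒢.L2 μ := fun r ↦ 𝒢.rightRegular μ (c r) (hF.toLp F) with hγ_def
  have hγc : Continuous γ := (𝒢.isStronglyContinuous_rightRegular_holds μ (hF.toLp F)).comp hc
  have hγi : Integrable γ ρ :=
    ⟨hγc.aestronglyMeasurable, HasFiniteIntegral.of_bounded (C := ‖hF.toLp F‖)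
      (Eventually.of_forall fun r ↦ (𝒢.norm_rightRegular_apply μ (c r) _).le)⟩
  have hd : Continuous fun r ↦ (c r)⁻¹ := hc.inv
  set T : 𝒢.L2 μ := ∫ r, γ r ∂ρ with hT
  have hTi : Integrable (T : 𝒢.automorphicQuotient → ℂ) μ := (Lp.memLp T).integrable one_le_two
  have hH : Integrable (fun p : ℝ × 𝒢.automorphicQuotient ↦ F ((c p.1)⁻¹ • p.2)) (ρ.prod μ) := by
    have := 𝒢.integrable_mul_comp_curve_smul μ hd ρ hF (memLp_const 1)
    simpa only [one_mul] using this
  have hSi : Integrable (fun y ↦ ∫ r, F ((c r)⁻¹ • y) ∂ρ) μ := hH.integral_prod_right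
  refine hTi.ae_eq_of_forall_setIntegral_eq _ _ hSi fun A hA hμA ↦ ?_
  have hind : MemLp (A.indicator fun _ ↦ (1 : ℂ)) 2 μ :=
    memLp_indicator_const 2 hA 1 (Or.inr hμA.ne)
  have hrep : ∀ r, (γ r : 𝒢.automorphicQuotient → ℂ) =ᵐ[μ] fun y ↦ F ((c r)⁻¹ • y) := fun r ↦
    (𝒢.rightRegular_apply_coeFn μ (c r) (hF.toLp F)).trans
      ((measurePreserving_smul (c r)⁻¹ μ).quasiMeasurePreserving.ae_eq_comp hF.coeFn_toLp)
  calc ∫ x in A, (T : 𝒢.automorphicQuotient → ℂ) x ∂μ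
      = ⟪indicatorConstLp 2 hA hμA.ne (1 : ℂ), T⟫_ℂ :=
        (L2.inner_indicatorConstLp_one hA hμA.ne T).symm
    _ = ∫ r, ⟪indicatorConstLp 2 hA hμA.ne (1 : ℂ), γ r⟫_ℂ ∂ρ := by
        rw [hT, ← integral_inner hγi]
    _ = ∫ r, ∫ x, A.indicator (fun _ ↦ (1 : ℂ)) x * F ((c r)⁻¹ • x) ∂μ ∂ρ := by
        congr 1 with r
        rw [L2.inner_indicatorConstLp_one, ← integral_indicator hA]
        refine integral_congr_ae ?_
        filter_upwards [hrep r] with x hx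
        by_cases hxA : x ∈ A
        · simp only [indicator_of_mem hxA, one_mul, hx]
        · simp only [indicator_of_notMem hxA, zero_mul]
    _ = ∫ x, ∫ r, A.indicator (fun _ ↦ (1 : ℂ)) x * F ((c r)⁻¹ • x) ∂ρ ∂μ :=
        integral_integral_swap (𝒢.integrable_mul_comp_curve_smul μ hd ρ hF hind)
    _ = ∫ x, A.indicator (fun _ ↦ (1 : ℂ)) x * ∫ r, F ((c r)⁻¹ • x) ∂ρ ∂μ := by
        congr 1 with x
        exact integral_const_mul _ _
    _ = ∫ x in A, (∫ r, F ((c r)⁻¹ • x) ∂ρ) ∂μ := by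
        rw [← integral_indicator hA]
        congr 1 with x
        by_cases hxA : x ∈ A
        · simp only [indicator_of_mem hxA, one_mul]
        · simp only [indicator_of_notMem hxA, zero_mul]

end AdelicGroupData

/-! ### 3. The `L²`-derivative of the orbit map is the class of the Lie derivative -/

section L2Derivative

variable {K : Type} [Field K] [NumberField K] {𝒢 : AdelicGroupData K}
  {μ : Measure 𝒢.automorphicQuotient} [𝒢.IsAutomorphicMeasure μ]
  {A : Type*} [NormedCommRing A] [NormedAlgebra ℝ A] [NormedAlgebra ℚ A] [CompleteSpace A]
  [StarRing A] {N : Type*} [Fintype N] [DecidableEq N] (𝒟 : AutomorphyDatum 𝒢 A N)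

omit [𝒢.IsAutomorphicMeasure μ] in
/-- The one-parameter subgroup `t ↦ exp tX : ℝ → G(𝔸_K)` of `X ∈ 𝔤` through the archimedean
inclusion of an automorphy datum is continuous. Borel–Jacquet 1979, §4.1. [folklore] -/
theorem AutomorphyDatum.continuous_ofArch_expMem_smul (X : 𝒟.arch.lie) :
    Continuous fun t : ℝ ↦ 𝒟.ofArch (𝒟.arch.expMem (t • X)) :=
  𝒟.continuous_ofArch.comp (RealMatrixGroup.continuous_expMem_smul X)

omit [𝒢.IsAutomorphicMeasure μ] in
/-- **The fundamental theorem of calculus along `exp tX`, read on the automorphic quotient.**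
If `φ = invQuot f` is smooth in the archimedean variable with `X φ = invQuot f_X`, then for every
point `y` of the quotient `f ((exp tX)⁻¹ • y) - f y = ∫₀ᵗ f_X ((exp sX)⁻¹ • y) ds` (for
`y = [g⁻¹]` this is `φ (g exp tX) - φ g = ∫₀ᵗ (X φ)(g exp sX) ds`, D2 dictionary
`apply_inv_smul_toAutomorphicQuotient_inv`). Harish-Chandra 1953, §7 and §9. [folklore] -/
theorem apply_inv_smul_sub_eq_intervalIntegral {f f_X : 𝒢.automorphicQuotient → ℂ}
    (hφ : IsArchSmooth 𝒟.ofArch (invQuot 𝒢 f)) (X : 𝒟.arch.lie)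
    (hX : lieDeriv 𝒟.ofArch X (invQuot 𝒢 f) = invQuot 𝒢 f_X) (y : 𝒢.automorphicQuotient)
    (t : ℝ) :
    f ((𝒟.ofArch (𝒟.arch.expMem (t • X)))⁻¹ • y) - f y =
      ∫ s in (0 : ℝ)..t, f_X ((𝒟.ofArch (𝒟.arch.expMem (s • X)))⁻¹ • y) := by
  obtain ⟨x, rfl⟩ := QuotientGroup.mk_surjective y
  have e : (QuotientGroup.mk x : 𝒢.automorphicQuotient) = 𝒢.toAutomorphicQuotient (x⁻¹)⁻¹ := by
    rw [inv_inv]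
    rfl
  rw [e]
  simp_rw [apply_inv_smul_toAutomorphicQuotient_inv]
  have e0 : f (𝒢.toAutomorphicQuotient (x⁻¹)⁻¹) = invQuot 𝒢 f x⁻¹ := rfl
  rw [e0]
  simp_rw [← hX]
  exact hφ.sub_eq_intervalIntegral_lieDeriv 𝒟.ofArch X x⁻¹ t

/-- **`R(exp tX) [f] = [f] + ∫₀ᵗ R(exp sX) [f_X] ds` in `L²(μ)`** for an automorphic measure
`μ`, `f, f_X ∈ ℒ²(μ)`, `φ = invQuot f` smooth in the archimedean variable with `X φ = invQuot f_X`
(the integral is the Bochner integral of the continuous `L²`-valued orbit map of `[f_X]`): both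
sides are represented by `y ↦ f y + ∫₀ᵗ f_X ((exp sX)⁻¹ • y) ds`
(`apply_inv_smul_sub_eq_intervalIntegral`, `AdelicGroupData.coeFn_integral_rightRegular_toLp`).
Harish-Chandra 1953, §7 and §9 (p. 227); Getz–Hahn 2024, Def. 4.5 (b). [cite: HarishChandraTAMS1953, §7 (p. 209) and §9 (p. 227)] -/
theorem rightRegular_expMem_toLp_eq_add_intervalIntegral {f f_X : 𝒢.automorphicQuotient → ℂ}
    (hf : MemLp f 2 μ) (hfX : MemLp f_X 2 μ) (hφ : IsArchSmooth 𝒟.ofArch (invQuot 𝒢 f))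
    (X : 𝒟.arch.lie) (hX : lieDeriv 𝒟.ofArch X (invQuot 𝒢 f) = invQuot 𝒢 f_X) (t : ℝ) :
    𝒢.rightRegular μ (𝒟.ofArch (𝒟.arch.expMem (t • X))) (hf.toLp f) =
      hf.toLp f + ∫ s in (0 : ℝ)..t,
        𝒢.rightRegular μ (𝒟.ofArch (𝒟.arch.expMem (s • X))) (hfX.toLp f_X) := by
  set c : ℝ → 𝒢.Adelic := fun s ↦ 𝒟.ofArch (𝒟.arch.expMem (s • X)) with hc_def
  have hc : Continuous c := 𝒟.continuous_ofArch_expMem_smul X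
  refine Lp.ext ?_
  have hL : ((𝒢.rightRegular μ (c t) (hf.toLp f) : 𝒢.L2 μ) : 𝒢.automorphicQuotient → ℂ) =ᵐ[μ]
      fun y ↦ f ((c t)⁻¹ • y) :=
    (𝒢.rightRegular_apply_coeFn μ (c t) (hf.toLp f)).trans
      ((measurePreserving_smul (c t)⁻¹ μ).quasiMeasurePreserving.ae_eq_comp hf.coeFn_toLp)
  have hI1 := 𝒢.coeFn_integral_rightRegular_toLp μ hc (volume.restrict (Ioc 0 t)) hfX
  have hI2 := 𝒢.coeFn_integral_rightRegular_toLp μ hc (volume.restrict (Ioc t 0)) hfX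
  have hR : ((hf.toLp f + ∫ s in (0 : ℝ)..t, 𝒢.rightRegular μ (c s) (hfX.toLp f_X) : 𝒢.L2 μ) :
      𝒢.automorphicQuotient → ℂ) =ᵐ[μ] fun y ↦ f y + ∫ s in (0 : ℝ)..t, f_X ((c s)⁻¹ • y) := by
    simp only [intervalIntegral]
    filter_upwards [Lp.coeFn_add (hf.toLp f)
        ((∫ s in Ioc 0 t, 𝒢.rightRegular μ (c s) (hfX.toLp f_X)) -
          ∫ s in Ioc t 0, 𝒢.rightRegular μ (c s) (hfX.toLp f_X)),
      Lp.coeFn_sub (∫ s in Ioc 0 t, 𝒢.rightRegular μ (c s) (hfX.toLp f_X))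
        (∫ s in Ioc t 0, 𝒢.rightRegular μ (c s) (hfX.toLp f_X)),
      hf.coeFn_toLp, hI1, hI2] with y h1 h2 h3 h4 h5
    rw [h1, Pi.add_apply, h2, Pi.sub_apply, h3, h4, h5]
  filter_upwards [hL, hR] with y h1 h2
  rw [h1, h2]
  exact sub_eq_iff_eq_add'.mp (apply_inv_smul_sub_eq_intervalIntegral 𝒟 hφ X hX y t)

/-- **The `L²`-derivative of the orbit map is the class of the Lie derivative** (no boundedness
assumption). For an automorphic measure `μ`, `f, f_X ∈ ℒ²(μ)` and `φ = invQuot f` smooth in the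
archimedean variable with `X φ = invQuot f_X`, the orbit map `t ↦ R(exp tX) [f]` is differentiable
at `t = 0` in `L²(μ)` with derivative `[f_X]`: by `rightRegular_expMem_toLp_eq_add_intervalIntegral`
it is `[f] + ∫₀ᵗ R(exp sX) [f_X] ds` with a continuous integrand, to which the fundamental
theorem of calculus (`intervalIntegral.integral_hasDerivAt_right`) applies. Harish-Chandra 1953,
§7 (p. 209: `π_W(X) ψ = lim t⁻¹ {π(exp tX) ψ - ψ}`), §9 (p. 227) and the proof of Thm. 5 (p. 229);
Getz–Hahn 2024, Def. 4.5 (b). [cite: HarishChandraTAMS1953, §7 (p. 209) and Thm. 5 (proof, p. 229)] -/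
theorem hasDerivAt_rightRegular_expMem_toLp {f f_X : 𝒢.automorphicQuotient → ℂ}
    (hf : MemLp f 2 μ) (hfX : MemLp f_X 2 μ) (hφ : IsArchSmooth 𝒟.ofArch (invQuot 𝒢 f))
    (X : 𝒟.arch.lie) (hX : lieDeriv 𝒟.ofArch X (invQuot 𝒢 f) = invQuot 𝒢 f_X) :
    HasDerivAt (fun t : ℝ ↦ 𝒢.rightRegular μ (𝒟.ofArch (𝒟.arch.expMem (t • X))) (hf.toLp f))
      (hfX.toLp f_X) 0 := by
  have hc : Continuous fun s : ℝ ↦ 𝒟.ofArch (𝒟.arch.expMem (s • X)) :=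
    𝒟.continuous_ofArch_expMem_smul X
  set γ₁ : ℝ → 𝒢.L2 μ := fun s ↦
    𝒢.rightRegular μ (𝒟.ofArch (𝒟.arch.expMem (s • X))) (hfX.toLp f_X) with hγ₁
  have hγ₁c : Continuous γ₁ := (𝒢.isStronglyContinuous_rightRegular_holds μ (hfX.toLp f_X)).comp hc
  have hQ : (fun t : ℝ ↦ 𝒢.rightRegular μ (𝒟.ofArch (𝒟.arch.expMem (t • X))) (hf.toLp f)) =
      fun t ↦ hf.toLp f + ∫ s in (0 : ℝ)..t, γ₁ s :=
    funext fun t ↦ rightRegular_expMem_toLp_eq_add_intervalIntegral 𝒟 hf hfX hφ X hX t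
  have hD : HasDerivAt (fun t : ℝ ↦ ∫ s in (0 : ℝ)..t, γ₁ s) (γ₁ 0) 0 :=
    intervalIntegral.integral_hasDerivAt_right (hγ₁c.intervalIntegrable 0 0)
      (hγ₁c.stronglyMeasurableAtFilter _ _) hγ₁c.continuousAt
  have h0 : γ₁ 0 = hfX.toLp f_X := by
    simp only [hγ₁, RealMatrixGroup.expMem_zero_smul, map_one, one_apply_eq_self]
  rw [hQ, ← h0]
  exact hD.const_add _

/-- **The coefficient of the class of the Lie derivative is the derivative of the coefficient**
(no boundedness): under the hypotheses of `hasDerivAt_rightRegular_expMem_toLp`, for every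
`u ∈ L²(μ)` and `t₀ ∈ ℝ` the coefficient `t ↦ ⟪u, R(exp tX) [f]⟫` has derivative
`⟪u, R(exp t₀X) [f_X]⟫` at `t₀` (at `0` by the previous theorem, in general by translation,
`inner_rightRegular_expMem_smul_eq`). Harish-Chandra 1953, §7 (p. 209) and Thm. 5 (proof,
p. 229). [cite: HarishChandraTAMS1953, §7 (p. 209) and Thm. 5 (proof, p. 229)] -/
theorem hasDerivAt_inner_rightRegular_toLp_of_memLp {f f_X : 𝒢.automorphicQuotient → ℂ}
    (hf : MemLp f 2 μ) (hfX : MemLp f_X 2 μ) (hφ : IsArchSmooth 𝒟.ofArch (invQuot 𝒢 f))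
    (X : 𝒟.arch.lie) (hX : lieDeriv 𝒟.ofArch X (invQuot 𝒢 f) = invQuot 𝒢 f_X) (u : 𝒢.L2 μ)
    (t₀ : ℝ) :
    HasDerivAt (fun t : ℝ ↦ ⟪u, 𝒢.rightRegular μ (𝒟.ofArch (𝒟.arch.expMem (t • X))) (hf.toLp f)⟫_ℂ)
      ⟪u, 𝒢.rightRegular μ (𝒟.ofArch (𝒟.arch.expMem (t₀ • X))) (hfX.toLp f_X)⟫_ℂ t₀ := by
  have hγ := hasDerivAt_rightRegular_expMem_toLp 𝒟 hf hfX hφ X hX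
  have h0 : ∀ u' : 𝒢.L2 μ, HasDerivAt
      (fun t : ℝ ↦ ⟪u', 𝒢.rightRegular μ (𝒟.ofArch (𝒟.arch.expMem (t • X))) (hf.toLp f)⟫_ℂ)
      ⟪u', hfX.toLp f_X⟫_ℂ 0 := by
    intro u'
    have := ((innerSL ℂ u').restrictScalars ℝ).hasFDerivAt.comp_hasDerivAt 0 hγ
    simpa only [Function.comp_def, ContinuousLinearMap.coe_restrictScalars',
      innerSL_apply_apply] using this
  set u' := ContinuousLinearMap.adjoint (𝒢.rightRegular μ (𝒟.ofArch (𝒟.arch.expMem (t₀ • X)))) u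
  have key : (fun t : ℝ ↦
      ⟪u, 𝒢.rightRegular μ (𝒟.ofArch (𝒟.arch.expMem (t • X))) (hf.toLp f)⟫_ℂ) =
      fun t : ℝ ↦ ⟪u', 𝒢.rightRegular μ (𝒟.ofArch (𝒟.arch.expMem ((t - t₀) • X))) (hf.toLp f)⟫_ℂ := by
    funext t
    exact inner_rightRegular_expMem_smul_eq 𝒟 X t₀ t u (hf.toLp f)
  have hval : ⟪u', hfX.toLp f_X⟫_ℂ =
      ⟪u, 𝒢.rightRegular μ (𝒟.ofArch (𝒟.arch.expMem (t₀ • X))) (hfX.toLp f_X)⟫_ℂ :=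
    ContinuousLinearMap.adjoint_inner_left _ _ _
  rw [key, ← hval]
  have h1 := h0 u'
  rw [← sub_self t₀] at h1
  exact h1.comp_sub_const t₀ t₀

/-- **Harish-Chandra's closure theorem along one-parameter subgroups, from analyticity of the
coefficients, for square-integrable Lie derivatives** (the statement of
`closure_l2OfForms_exp_invariant_of_analytic` without the boundedness hypothesis, for an
automorphic measure). Let `W` be a space of functions on `G(𝔸_K)` stable under the Lie
derivatives, whose elements are archimedean-smooth and of the form `invQuot f`, `f ∈ ℒ²(μ)`, and
such that the coefficients `t ↦ ⟪u, R(exp tX) [f]⟫`, `invQuot f ∈ W`, are analytic at `0`. Then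
the closure of `[W] = l2OfForms W` is `R(exp X)`-invariant for every `X ∈ 𝔤`. The proof is that
of Harish-Chandra 1953, Cor. to Thm. 2 (pp. 210–211; Libine 2012, Cor. 73), word for word as in
`closure_l2OfForms_exp_invariant_of_analytic`, with `hasDerivAt_inner_rightRegular_toLp_of_memLp`
supplying the derivatives. [cite: HarishChandraTAMS1953, Cor. to Thm. 2 (pp. 210–211)] -/
theorem closure_l2OfForms_exp_invariant_of_analytic_of_memLp {W : Submodule ℂ (𝒢.Adelic → ℂ)}
    (hlie : ∀ X : 𝒟.arch.lie, ∀ φ ∈ W, lieDeriv 𝒟.ofArch X φ ∈ W)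
    (hsm : ∀ φ ∈ W, IsArchSmooth 𝒟.ofArch φ)
    (hrep : ∀ φ ∈ W, ∃ (f : 𝒢.automorphicQuotient → ℂ) (_ : MemLp f 2 μ), invQuot 𝒢 f = φ)
    (hana : ∀ (f : 𝒢.automorphicQuotient → ℂ) (hf : MemLp f 2 μ), invQuot 𝒢 f ∈ W →
      ∀ (X : 𝒟.arch.lie) (u : 𝒢.L2 μ),
        AnalyticAt ℝ (fun t : ℝ ↦
          ⟪u, 𝒢.rightRegular μ (𝒟.ofArch (𝒟.arch.expMem (t • X))) (hf.toLp f)⟫_ℂ) 0)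
    (X : 𝒟.arch.lie) {y : 𝒢.L2 μ} (hy : y ∈ (l2OfForms 𝒢 μ W).topologicalClosure) :
    𝒢.rightRegular μ (𝒟.ofArch (𝒟.arch.expMem X)) y ∈ (l2OfForms 𝒢 μ W).topologicalClosure := by
  -- notation: the coefficient of the class of `f` against `u`
  let coeff : (f : 𝒢.automorphicQuotient → ℂ) → MemLp f 2 μ → 𝒢.L2 μ → ℝ → ℂ :=
    fun f hf u t ↦ ⟪u, 𝒢.rightRegular μ (𝒟.ofArch (𝒟.arch.expMem (t • X))) (hf.toLp f)⟫_ℂ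
  -- (1) the derivative of a coefficient is the coefficient of the Lie derivative
  have hderiv : ∀ (f : 𝒢.automorphicQuotient → ℂ) (hf : MemLp f 2 μ), invQuot 𝒢 f ∈ W →
      ∀ u : 𝒢.L2 μ, ∃ (f' : 𝒢.automorphicQuotient → ℂ) (hf' : MemLp f' 2 μ),
        invQuot 𝒢 f' ∈ W ∧ deriv (coeff f hf u) = coeff f' hf' u := by
    intro f hf hfW u
    obtain ⟨f', hf', hf'eq⟩ := hrep _ (hlie X _ hfW)
    refine ⟨f', hf', hf'eq ▸ hlie X _ hfW, funext fun t₀ ↦ ?_⟩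
    exact (hasDerivAt_inner_rightRegular_toLp_of_memLp 𝒟 hf hf' (hsm _ hfW) X hf'eq.symm
      u t₀).deriv
  -- (2) all iterated derivatives of a coefficient are coefficients of classes of `W`
  have hiter : ∀ (k : ℕ) (f : 𝒢.automorphicQuotient → ℂ) (hf : MemLp f 2 μ), invQuot 𝒢 f ∈ W →
      ∀ u : 𝒢.L2 μ, ∃ (f' : 𝒢.automorphicQuotient → ℂ) (hf' : MemLp f' 2 μ),
        invQuot 𝒢 f' ∈ W ∧ iteratedDeriv k (coeff f hf u) = coeff f' hf' u := by
    intro k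
    induction k with
    | zero => exact fun f hf hfW u ↦ ⟨f, hf, hfW, iteratedDeriv_zero⟩
    | succ k ih =>
      intro f hf hfW u
      obtain ⟨f₁, hf₁, hf₁W, h₁⟩ := hderiv f hf hfW u
      obtain ⟨f', hf', hf'W, h'⟩ := ih f₁ hf₁ hf₁W u
      exact ⟨f', hf', hf'W, by rw [iteratedDeriv_succ', h₁, h']⟩
  -- (3) coefficients against `u ⊥ [W]` vanish identically
  have hvanish : ∀ (f : 𝒢.automorphicQuotient → ℂ) (hf : MemLp f 2 μ), invQuot 𝒢 f ∈ W →
      ∀ u ∈ (l2OfForms 𝒢 μ W)ᗮ, ∀ t : ℝ, coeff f hf u t = 0 := by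
    intro f hf hfW u hu
    have hval0 : ∀ (f' : 𝒢.automorphicQuotient → ℂ) (hf' : MemLp f' 2 μ), invQuot 𝒢 f' ∈ W →
        coeff f' hf' u 0 = 0 := by
      intro f' hf' hf'W
      simp only [coeff, RealMatrixGroup.expMem_zero_smul, map_one, one_apply_eq_self]
      exact Submodule.inner_left_of_mem_orthogonal (toLp_mem_l2OfForms hf' hf'W) hu
    have hider0 : ∀ k : ℕ, iteratedDeriv k (coeff f hf u) 0 = 0 := by
      intro k
      obtain ⟨f', hf', hf'W, h'⟩ := hiter k f hf hfW u
      rw [h', hval0 f' hf' hf'W]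
    have han : AnalyticOnNhd ℝ (coeff f hf u) Set.univ := fun t₀ _ ↦
      analyticAt_inner_rightRegular_of_zero 𝒟 X (hf.toLp f) (hana f hf hfW X) u t₀
    have hzero : coeff f hf u =ᶠ[𝓝 0] 0 := by
      obtain ⟨p, r, hp⟩ := hana f hf hfW X u
      filter_upwards [Metric.eball_mem_nhds (0 : ℝ) hp.r_pos] with s hs
      have hsum := hp.hasSum_iteratedFDeriv hs
      have hterm : (fun k : ℕ ↦ ((Nat.factorial k : ℕ) : ℝ)⁻¹ •
          iteratedFDeriv ℝ k (coeff f hf u) 0 fun _ ↦ s) = fun _ ↦ 0 := by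
        funext k
        rw [iteratedFDeriv_apply_eq_iteratedDeriv_mul_prod, hider0 k, smul_zero, smul_zero]
      rw [hterm, zero_add] at hsum
      exact hsum.unique hasSum_zero
    have heq := han.eqOn_zero_of_preconnected_of_eventuallyEq_zero isPreconnected_univ
      (Set.mem_univ (0 : ℝ)) hzero
    exact fun t ↦ heq (Set.mem_univ t)
  -- (4) classes of `W` stay in `Cl[W] = [W]ᗮᗮ` under `R(exp X)`
  have hgen : ∀ x ∈ l2OfForms 𝒢 μ W,
      𝒢.rightRegular μ (𝒟.ofArch (𝒟.arch.expMem X)) x ∈ (l2OfForms 𝒢 μ W).topologicalClosure := by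
    rintro x ⟨f, hf, rfl, hfW⟩
    rw [← Submodule.orthogonal_orthogonal_eq_closure, Submodule.mem_orthogonal]
    intro u hu
    have := hvanish f hf hfW u hu 1
    simpa only [coeff, one_smul] using this
  -- (5) continuity of `R(exp X)`
  exact apply_mem_topologicalClosure_of_forall_mem _ hgen hy

end L2Derivative

/-! ### 4. Step 3a of Borel–Jacquet 4.6 from Harish-Chandra's Lemma 34 alone -/

section GeneralLinear

open NumberField.mixedEmbedding IsDedekindDomain

variable {n : ℕ} {K : Type} [Field K] [NumberField K]
  {hcpt : isCompact_glFiniteIntegralLevel n K}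
  {μ : Measure (AdelicGroupData.gl n K).automorphicQuotient}
  [(AdelicGroupData.gl n K).IsAutomorphicMeasure μ]

/-- **Step 3a of Borel–Jacquet 4.6 from Harish-Chandra's Lemma 34 alone.** The named fact
`formsOfL2_coeff_analyticAt hcpt μ` (analyticity at `0` of the matrix coefficients of the classes
of `V_Π` along one-parameter subgroups: Harish-Chandra 1953, Lemma 34; Libine 2012, Thm. 72)
implies `formsOfL2_closure_exp_invariant hcpt μ`, with no boundedness input: a stable `W ≤ V_Π`
is `𝔤`-stable, consists of archimedean-smooth automorphic forms, and its elements — in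
particular all Lie derivatives of its elements — are `invQuot f` with `f ∈ ℒ²(μ)`, `[f] ∈ Π`
(`exists_toLp_mem_of_mem_formsOfL2`), so `closure_l2OfForms_exp_invariant_of_analytic_of_memLp`
applies. Hence the trust base of F3a is `{formsOfL2_coeff_analyticAt}`. Harish-Chandra 1953,
Cor. to Thm. 2 and Lemma 34; Libine 2012, Cor. 73; Borel–Jacquet 1979, 4.6. [cite: HarishChandraTAMS1953, Cor. to Thm. 2 (pp. 210–211) and Lemma 34] -/
theorem AutomorphicRepsGL.formsOfL2_closure_exp_invariant_of_coeff_analyticAt'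
    (hA : AutomorphicRepsGL.formsOfL2_coeff_analyticAt hcpt μ) :
    AutomorphicRepsGL.formsOfL2_closure_exp_invariant hcpt μ := by
  intro P W hWV hW X y hy
  refine closure_l2OfForms_exp_invariant_of_analytic_of_memLp (AutomorphyDatum.gl n K hcpt)
    hW.lie_stable (fun φ hφ ↦ ?_) (fun φ hφ ↦ ?_) (fun f hf hfW X u ↦ ?_) X hy
  · exact automorphicForms_le_archSmooth _ (hW.le_automorphicForms hφ)
  · obtain ⟨f, hf, -, rfl, -⟩ := exists_toLp_mem_of_mem_formsOfL2 (hWV hφ)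
    exact ⟨f, hf, rfl⟩
  · exact hA P f hf (hWV hfW) X u

/-- **Step 3 of Borel–Jacquet 4.6 (irreducibility of `V_Π`) on the trust base
`{formsOfL2_coeff_analyticAt, formsOfL2_mem_of_toLp_mem_closure}`**: Harish-Chandra's Lemma 34
(through `formsOfL2_closure_exp_invariant_of_coeff_analyticAt'`) and Step 3b give
`formsOfL2_irreducible hcpt μ` (`formsOfL2_irreducible_of`). Harish-Chandra 1953, Thm. 5; Libine
2012, Cor. 75. [cite: Libine2012, Cor. 75] -/
theorem AutomorphicRepsGL.formsOfL2_irreducible_of_coeff_analyticAt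
    (hA : AutomorphicRepsGL.formsOfL2_coeff_analyticAt hcpt μ)
    (h₃b : AutomorphicRepsGL.formsOfL2_mem_of_toLp_mem_closure hcpt μ) :
    AutomorphicRepsGL.formsOfL2_irreducible hcpt μ :=
  AutomorphicRepsGL.formsOfL2_irreducible_of
    (AutomorphicRepsGL.formsOfL2_closure_exp_invariant_of_coeff_analyticAt' hA) h₃b

end GeneralLinear

end Literature.NumberTheory.Automorphic
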